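import Summits.AtomisticToContinuum.Crystallization.Theorems.ThreeConeCertificateExactCertificateStructureFactor

/-!
# `ExactCertificate` (stmt-AtomisticToContinuum-11959), line `closure-makes-nogap-exact`:
# complementary slackness of a witness, IV — the second moment of the structure factor

Continuation of `…StructureFactor`.  For a three-cone split `IsSplit ρ c g U f` whose value attains
a periodic configuration, `c + f 0 / 2 ≤ −e(P)`, the `f`-weighted structure factor
`S_f(k) = f 0 + (#F)⁻¹ Σ_{x ∈ F} Σ'_{y ∈ P, y ≠ x} cos⟪k, x − y⟫ · f(|x − y|)` is `≥ 0` everywhere and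
`= 0` at `k = 0` (`Fourier.structureFactor_nonneg`, `Fourier.structureFactor_zero`), so `k = 0` is
a minimum of `S_f`.  This file draws the SECOND-ORDER consequence (registered stub
`stub_secondMoment`): in every direction `u`,
`Σ_{x ∈ F} Σ'_{y ∈ P, y ≠ x} ⟪u, x − y⟫² · f(|x − y|) ≤ 0`,
together with the absolute summability of these second-moment site families (termwise
`f = V_LJ − g` on the distances of `P`, `r² |V_LJ(r)| ≤ r⁻¹⁰/12 + r⁻⁴/6`, and `r² |g r|` has finite
range).  Mechanism: `0 ≤ t⁻² (S_f(t u) − S_f(0)) = (#F)⁻¹ Σ_x Σ'_y t⁻² (cos (t⟪u, x − y⟫) − 1) f`,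
and `t → 0` under the `tsum` by dominated convergence (Tannery; domination
`|t⁻² (cos (tθ) − 1)| ≤ θ²/2`, limit `−θ²/2` from `Real.cos_bound`).  All `[folklore]`.
-/

noncomputable section

namespace Summit.AtomisticToContinuum.Crystallization.Theorems.ThreeConeCertificateExactCertificate.Fourier

open Literature.MathematicalPhysics.StatisticalMechanics
open Summit.AtomisticToContinuum.Crystallization.Theorems.ChargedEnergyGapNegative (E3)
open Summit.AtomisticToContinuum.Crystallization.Theorems.ExactCertificateNegative (IsSplit)
open Summit.AtomisticToContinuum.Crystallization.Theorems.ThreeConeCertificateExactCertificate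
  (Slackness.summable_f_site Slackness.U_site_eq_zero Slackness.summable_of_finRange)
open scoped BigOperators Topology
open Filter

/-! ## Two elementary estimates on `t⁻² (cos (tθ) − 1)` -/

/-- **Domination**: `|t⁻² (cos (tθ) − 1)| ≤ θ² / 2` for all real `t, θ` (from
`1 − x²/2 ≤ cos x ≤ 1`). [folklore] -/
theorem abs_inv_sq_mul_cos_sub_one_le (t θ : ℝ) :
    |t⁻¹ ^ 2 * (Real.cos (t * θ) - 1)| ≤ θ ^ 2 / 2 := by
  have h1 := Real.one_sub_sq_div_two_le_cos (x := t * θ)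
  have h2 := Real.cos_le_one (t * θ)
  rw [abs_mul, abs_of_nonneg (by positivity : (0 : ℝ) ≤ t⁻¹ ^ 2),
    abs_of_nonpos (by linarith : Real.cos (t * θ) - 1 ≤ 0)]
  have h3 : t⁻¹ ^ 2 * -(Real.cos (t * θ) - 1) ≤ t⁻¹ ^ 2 * ((t * θ) ^ 2 / 2) :=
    mul_le_mul_of_nonneg_left (by linarith) (by positivity)
  have h4 : t⁻¹ ^ 2 * ((t * θ) ^ 2 / 2) ≤ θ ^ 2 / 2 := by
    have h5 : (t⁻¹ * t) ^ 2 ≤ 1 := by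
      by_cases ht : t = 0
      · simp [ht]
      · simp [inv_mul_cancel₀ ht]
    have e : t⁻¹ ^ 2 * ((t * θ) ^ 2 / 2) = (t⁻¹ * t) ^ 2 * (θ ^ 2 / 2) := by ring
    rw [e]
    exact mul_le_of_le_one_left (by positivity) h5
  exact h3.trans h4

/-- **Pointwise limit**: `t⁻² (cos (tθ) − 1) → −θ²/2` as `t → 0`, `t ≠ 0` (from
`Real.cos_bound`: `|cos x − (1 − x²/2)| ≤ (5/96)|x|⁴` for `|x| ≤ 1`). [folklore] -/
theorem tendsto_inv_sq_mul_cos_sub_one (θ : ℝ) :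
    Tendsto (fun t : ℝ => t⁻¹ ^ 2 * (Real.cos (t * θ) - 1)) (𝓝[≠] 0) (𝓝 (-(θ ^ 2 / 2))) := by
  have hev : ∀ᶠ t : ℝ in 𝓝[≠] 0, |t * θ| ≤ 1 := by
    have h1 : Tendsto (fun t : ℝ => t * θ) (𝓝 0) (𝓝 0) :=
      (continuous_mul_const θ).tendsto' 0 0 (zero_mul θ)
    have h2 : ∀ᶠ t : ℝ in 𝓝 0, |t * θ| ≤ 1 := by
      filter_upwards [h1.eventually_mem (Metric.closedBall_mem_nhds (0 : ℝ) one_pos)] with t ht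
      rwa [Metric.mem_closedBall, Real.dist_eq, sub_zero] at ht
    exact h2.filter_mono nhdsWithin_le_nhds
  have hne : ∀ᶠ t : ℝ in 𝓝[≠] 0, t ≠ 0 := self_mem_nhdsWithin
  rw [tendsto_iff_norm_sub_tendsto_zero]
  refine squeeze_zero' (Eventually.of_forall fun t => norm_nonneg _)
    (g := fun t => t ^ 2 * θ ^ 4 * (5 / 96)) ?_ ?_
  · filter_upwards [hev, hne] with t ht ht0
    rw [Real.norm_eq_abs]
    have hb := Real.cos_bound ht
    have e : t⁻¹ ^ 2 * (Real.cos (t * θ) - 1) - -(θ ^ 2 / 2) =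
        t⁻¹ ^ 2 * (Real.cos (t * θ) - (1 - (t * θ) ^ 2 / 2)) := by
      field_simp
      ring
    rw [e, abs_mul, abs_of_nonneg (by positivity : (0 : ℝ) ≤ t⁻¹ ^ 2)]
    calc t⁻¹ ^ 2 * |Real.cos (t * θ) - (1 - (t * θ) ^ 2 / 2)|
        ≤ t⁻¹ ^ 2 * (|t * θ| ^ 4 * (5 / 96)) := mul_le_mul_of_nonneg_left hb (by positivity)
      _ = t ^ 2 * θ ^ 4 * (5 / 96) := by
          rw [pow_abs, abs_of_nonneg (by positivity : (0 : ℝ) ≤ (t * θ) ^ 4)]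
          field_simp
  · have hc : Continuous fun t : ℝ => t ^ 2 * θ ^ 4 * (5 / 96) := by fun_prop
    have h0 := hc.tendsto 0
    rw [show (0 : ℝ) ^ 2 * θ ^ 4 * (5 / 96) = 0 by ring] at h0
    exact h0.mono_left nhdsWithin_le_nhds

/-! ## Second-moment site families of a witness -/

section Witness

variable {P : PeriodicConfiguration 3} {ρ c : ℝ} {g U f : ℝ → ℝ}

/-- `r² |V_LJ(r)| ≤ r⁻¹⁰/12 + r⁻⁴/6` for `r > 0`. [folklore] -/
theorem sq_mul_abs_lennardJones_le {r : ℝ} (hr : 0 < r) :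
    r ^ 2 * |lennardJones r| ≤ 1 / 12 * r⁻¹ ^ 10 + 1 / 6 * r⁻¹ ^ 4 := by
  unfold lennardJones
  have e1 : r ^ 2 * (1 / 12 * r⁻¹ ^ 12) = 1 / 12 * r⁻¹ ^ 10 := by field_simp
  have e2 : r ^ 2 * (1 / 6 * r⁻¹ ^ 6) = 1 / 6 * r⁻¹ ^ 4 := by field_simp
  calc r ^ 2 * |1 / 12 * r⁻¹ ^ 12 - 1 / 6 * r⁻¹ ^ 6|
      ≤ r ^ 2 * (|1 / 12 * r⁻¹ ^ 12| + |1 / 6 * r⁻¹ ^ 6|) :=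
        mul_le_mul_of_nonneg_left (abs_sub _ _) (sq_nonneg r)
    _ = 1 / 12 * r⁻¹ ^ 10 + 1 / 6 * r⁻¹ ^ 4 := by
        rw [abs_of_nonneg (by positivity : (0 : ℝ) ≤ 1 / 12 * r⁻¹ ^ 12),
          abs_of_nonneg (by positivity : (0 : ℝ) ≤ 1 / 6 * r⁻¹ ^ 6), mul_add, e1, e2]

/-- For a witness the site families `y ↦ |x − y|² · |f(|x − y|)|` of `P` are summable: termwise
`f = V_LJ − g` on the distances of `P`, `r²|V_LJ| ≤ r⁻¹⁰/12 + r⁻⁴/6` (summable inverse powers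
`> 3`) and `r² |g r|` has finite range. [folklore] -/
theorem summable_sq_mul_abs_f_site (h : IsSplit ρ c g U f)
    (hv : c + f 0 / 2 ≤ -(P.energyPerParticle lennardJones)) {x : E3} (hx : x ∈ P.points) :
    Summable fun q : {q : E3 // q ∈ P.points ∧ q ≠ x} =>
      (dist x q.1) ^ 2 * |f (dist x q.1)| := by
  have h10 := P.summable_inv_pow_dist (show 3 < 10 by norm_num) x
  have h4 := P.summable_inv_pow_dist (show 3 < 4 by norm_num) x
  have hg := Slackness.summable_of_finRange P (W := fun r => r ^ 2 * |g r|) (ρ := ρ)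
    (fun r hr => by simp only [h.g_zero r hr, abs_zero, mul_zero]) x
  refine Summable.of_nonneg_of_le (fun q => by positivity) (fun q => ?_)
    (((h10.mul_left (1 / 12)).add (h4.mul_left (1 / 6))).add hg)
  have hd : 0 < dist x q.1 := dist_pos.2 (fun heq => q.2.2 heq.symm)
  have h1 := h.split _ hd
  have h2 := Slackness.U_site_eq_zero h hv hx q
  have hf : f (dist x q.1) = lennardJones (dist x q.1) - g (dist x q.1) := by linarith
  rw [hf]
  have h3 := sq_mul_abs_lennardJones_le hd
  calc (dist x q.1) ^ 2 * |lennardJones (dist x q.1) - g (dist x q.1)|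
      ≤ (dist x q.1) ^ 2 * (|lennardJones (dist x q.1)| + |g (dist x q.1)|) :=
        mul_le_mul_of_nonneg_left (abs_sub _ _) (sq_nonneg _)
    _ = (dist x q.1) ^ 2 * |lennardJones (dist x q.1)| + (dist x q.1) ^ 2 * |g (dist x q.1)| :=
        mul_add _ _ _
    _ ≤ 1 / 12 * (dist x q.1)⁻¹ ^ 10 + 1 / 6 * (dist x q.1)⁻¹ ^ 4 +
          (dist x q.1) ^ 2 * |g (dist x q.1)| := by linarith

/-- **Summability of the second-moment site families** of a witness: in every direction `u`,
`y ↦ ⟪u, x − y⟫² · f(|x − y|)` is summable over the points `y ≠ x` of `P`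
(`⟪u, x − y⟫² ≤ ‖u‖² |x − y|²`). [folklore] -/
theorem summable_inner_sq_mul_f_site (h : IsSplit ρ c g U f)
    (hv : c + f 0 / 2 ≤ -(P.energyPerParticle lennardJones)) {x : E3} (hx : x ∈ P.points)
    (u : E3) :
    Summable fun q : {q : E3 // q ∈ P.points ∧ q ≠ x} =>
      (inner ℝ u (x - q.1)) ^ 2 * f (dist x q.1) := by
  refine Summable.of_norm_bounded ((summable_sq_mul_abs_f_site h hv hx).mul_left (‖u‖ ^ 2))
    fun q => ?_
  rw [Real.norm_eq_abs, abs_mul, abs_of_nonneg (sq_nonneg _), ← mul_assoc]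
  refine mul_le_mul_of_nonneg_right ?_ (abs_nonneg _)
  have h1 := abs_real_inner_le_norm u (x - q.1)
  rw [← dist_eq_norm] at h1
  rw [← sq_abs (inner ℝ u (x - q.1)), ← mul_pow]
  exact pow_le_pow_left₀ (abs_nonneg _) h1 2

/-- **First-order difference of structure factors**: `0 ≤ S_f(k) − S_f(0)`, i.e.
`0 ≤ Σ_{x ∈ F} Σ'_y (cos⟪k, x − y⟫ − 1) · f(|x − y|)` for every wave vector `k`. [folklore] -/
theorem sum_tsum_cos_sub_one_mul_nonneg (h : IsSplit ρ c g U f)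
    (hv : c + f 0 / 2 ≤ -(P.energyPerParticle lennardJones)) (k : E3) :
    0 ≤ ∑ x ∈ P.motif, ∑' q : {q : E3 // q ∈ P.points ∧ q ≠ x},
      (Real.cos (inner ℝ k (x - q.1)) - 1) * f (dist x q.1) := by
  have hF : (0 : ℝ) < P.motif.card := by exact_mod_cast P.motif_nonempty.card_pos
  have h1 := structureFactor_nonneg h hv k
  have h2 := structureFactor_zero h hv
  have h3 : ∀ x ∈ P.motif, ∑' q : {q : E3 // q ∈ P.points ∧ q ≠ x},
      (Real.cos (inner ℝ k (x - q.1)) - 1) * f (dist x q.1) =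
      ∑' q : {q : E3 // q ∈ P.points ∧ q ≠ x}, Real.cos (inner ℝ k (x - q.1)) * f (dist x q.1) -
        ∑' q : {q : E3 // q ∈ P.points ∧ q ≠ x}, f (dist x q.1) := by
    intro x hx
    have hs := Slackness.summable_f_site h hv (P.mem_points_of_mem_motif hx)
    rw [← (summable_kernel P k f hs).tsum_sub hs]
    refine tsum_congr fun q => ?_
    ring
  rw [Finset.sum_congr rfl h3, Finset.sum_sub_distrib]
  have h4 : 0 ≤ (P.motif.card : ℝ)⁻¹ *
      (∑ x ∈ P.motif, ∑' q : {q : E3 // q ∈ P.points ∧ q ≠ x},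
          Real.cos (inner ℝ k (x - q.1)) * f (dist x q.1) -
        ∑ x ∈ P.motif, ∑' q : {q : E3 // q ∈ P.points ∧ q ≠ x}, f (dist x q.1)) := by
    rw [mul_sub]
    linarith
  have h5 := mul_nonneg hF.le h4
  rwa [← mul_assoc, mul_inv_cancel₀ hF.ne', one_mul] at h5

/-- The scaled differences `t⁻² (S_f(t u) − S_f(0))` are non-negative:
`0 ≤ Σ_{x ∈ F} Σ'_y t⁻² (cos (t⟪u, x − y⟫) − 1) · f(|x − y|)` for every real `t`. [folklore] -/
theorem sum_tsum_scaled_nonneg (h : IsSplit ρ c g U f)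
    (hv : c + f 0 / 2 ≤ -(P.energyPerParticle lennardJones)) (u : E3) (t : ℝ) :
    0 ≤ ∑ x ∈ P.motif, ∑' q : {q : E3 // q ∈ P.points ∧ q ≠ x},
      t⁻¹ ^ 2 * ((Real.cos (t * inner ℝ u (x - q.1)) - 1) * f (dist x q.1)) := by
  have h1 := sum_tsum_cos_sub_one_mul_nonneg h hv (t • u)
  simp_rw [real_inner_smul_left] at h1
  simp_rw [tsum_mul_left]
  rw [← Finset.mul_sum]
  exact mul_nonneg (by positivity) h1

/-- **Dominated convergence under the site sum**: as `t → 0`, `t ≠ 0`,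
`Σ'_y t⁻² (cos (t⟪u, x − y⟫) − 1) f(|x − y|) → Σ'_y −½ ⟪u, x − y⟫² f(|x − y|)` (Tannery's theorem,
domination by `½ ⟪u, x − y⟫² |f(|x − y|)|`). [folklore] -/
theorem tendsto_tsum_scaled (h : IsSplit ρ c g U f)
    (hv : c + f 0 / 2 ≤ -(P.energyPerParticle lennardJones)) {x : E3} (hx : x ∈ P.points)
    (u : E3) :
    Tendsto (fun t : ℝ => ∑' q : {q : E3 // q ∈ P.points ∧ q ≠ x},
        t⁻¹ ^ 2 * ((Real.cos (t * inner ℝ u (x - q.1)) - 1) * f (dist x q.1))) (𝓝[≠] 0)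
      (𝓝 (∑' q : {q : E3 // q ∈ P.points ∧ q ≠ x},
        -(1 / 2) * ((inner ℝ u (x - q.1)) ^ 2 * f (dist x q.1)))) := by
  refine tendsto_tsum_of_dominated_convergence
    (bound := fun q : {q : E3 // q ∈ P.points ∧ q ≠ x} =>
      1 / 2 * |(inner ℝ u (x - q.1)) ^ 2 * f (dist x q.1)|)
    ((summable_inner_sq_mul_f_site h hv hx u).abs.mul_left (1 / 2)) (fun q => ?_)
    (Eventually.of_forall fun t q => ?_)
  · have e1 : (fun t : ℝ => t⁻¹ ^ 2 * ((Real.cos (t * inner ℝ u (x - q.1)) - 1) * f (dist x q.1)))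
        = fun t : ℝ => t⁻¹ ^ 2 * (Real.cos (t * inner ℝ u (x - q.1)) - 1) * f (dist x q.1) := by
      funext t
      ring
    have e2 : -(1 / 2) * ((inner ℝ u (x - q.1)) ^ 2 * f (dist x q.1)) =
        -((inner ℝ u (x - q.1)) ^ 2 / 2) * f (dist x q.1) := by
      ring
    rw [e1, e2]
    exact (tendsto_inv_sq_mul_cos_sub_one (inner ℝ u (x - q.1))).mul_const (f (dist x q.1))
  · rw [Real.norm_eq_abs, ← mul_assoc, abs_mul, abs_mul ((inner ℝ u (x - q.1)) ^ 2),
      abs_of_nonneg (sq_nonneg (inner ℝ u (x - q.1)))]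
    calc |t⁻¹ ^ 2 * (Real.cos (t * inner ℝ u (x - q.1)) - 1)| * |f (dist x q.1)|
        ≤ (inner ℝ u (x - q.1)) ^ 2 / 2 * |f (dist x q.1)| :=
          mul_le_mul_of_nonneg_right (abs_inv_sq_mul_cos_sub_one_le t _) (abs_nonneg _)
      _ = 1 / 2 * ((inner ℝ u (x - q.1)) ^ 2 * |f (dist x q.1)|) := by ring

/-- **The second moment in a direction is `≤ 0`**:
`Σ_{x ∈ F} Σ'_y ⟪u, x − y⟫² · f(|x − y|) ≤ 0` (limit `t → 0` of the non-negative scaled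
differences, summed over the finite motif). [folklore] -/
theorem sum_tsum_inner_sq_mul_f_nonpos (h : IsSplit ρ c g U f)
    (hv : c + f 0 / 2 ≤ -(P.energyPerParticle lennardJones)) (u : E3) :
    ∑ x ∈ P.motif, ∑' q : {q : E3 // q ∈ P.points ∧ q ≠ x},
      (inner ℝ u (x - q.1)) ^ 2 * f (dist x q.1) ≤ 0 := by
  have hlim : Tendsto (fun t : ℝ => ∑ x ∈ P.motif, ∑' q : {q : E3 // q ∈ P.points ∧ q ≠ x},
      t⁻¹ ^ 2 * ((Real.cos (t * inner ℝ u (x - q.1)) - 1) * f (dist x q.1))) (𝓝[≠] 0)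
      (𝓝 (∑ x ∈ P.motif, ∑' q : {q : E3 // q ∈ P.points ∧ q ≠ x},
        -(1 / 2) * ((inner ℝ u (x - q.1)) ^ 2 * f (dist x q.1)))) :=
    tendsto_finsetSum _ fun x hx => tendsto_tsum_scaled h hv (P.mem_points_of_mem_motif hx) u
  have hge : 0 ≤ ∑ x ∈ P.motif, ∑' q : {q : E3 // q ∈ P.points ∧ q ≠ x},
      -(1 / 2) * ((inner ℝ u (x - q.1)) ^ 2 * f (dist x q.1)) :=
    ge_of_tendsto' hlim fun t => sum_tsum_scaled_nonneg h hv u t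
  simp_rw [tsum_mul_left] at hge
  rw [← Finset.mul_sum] at hge
  linarith

end Witness

/-- **Registered stub `stub_secondMoment` of the line `closure-makes-nogap-exact`** (signature
verbatim): for a witness `(P, ρ, c, g, U, f)` of the crux and every direction `u`, the
second-moment site families `y ↦ ⟪u, x − y⟫² f(|x − y|)` are summable over `P` at every motif
point and their motif sum is `≤ 0` — the second-order condition at the minimum `k = 0` of the
non-negative `f`-weighted structure factor. [folklore] -/
theorem stub_secondMoment : ∀ (P : PeriodicConfiguration 3) (ρ c : ℝ) (g U f : ℝ → ℝ),
    IsSplit ρ c g U f → c + f 0 / 2 ≤ -(P.energyPerParticle lennardJones) →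
    ∀ u : EuclideanSpace ℝ (Fin 3),
      (∀ x ∈ P.motif, Summable fun y : {y : EuclideanSpace ℝ (Fin 3) // y ∈ P.points ∧ y ≠ x} =>
        (inner ℝ u (x - y.1)) ^ 2 * f (dist x y.1)) ∧
      ∑ x ∈ P.motif, ∑' y : {y : EuclideanSpace ℝ (Fin 3) // y ∈ P.points ∧ y ≠ x},
        (inner ℝ u (x - y.1)) ^ 2 * f (dist x y.1) ≤ 0 :=
  fun P _ _ _ _ _ h hv u =>
    ⟨fun _ hx => summable_inner_sq_mul_f_site h hv (P.mem_points_of_mem_motif hx) u,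
      sum_tsum_inner_sq_mul_f_nonpos h hv u⟩

end Summit.AtomisticToContinuum.Crystallization.Theorems.ThreeConeCertificateExactCertificate.Fourier

end
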